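import Summits.RiemannHypothesis.RiemannHypothesis.Theorems.WeilFormatCWindowFamily
import HarnessLib

/-!
# Format C (Fourier–Galerkin certificates of Weil positivity): continuity of the window form along
  uniformly convergent window families

Helper file (`--supports stmt-RiemannHypothesis-0098`, lead-track anchor), RH-free. Seat
rh-explicit-weil-3 (gen3). Sequel of `WeilFormatCWindowFamily.lean` (window functions: measurable,
`0` off `[-a,a]`, `‖u‖ ≤ S₀`, `S₁`-Lipschitz on the closed window).

## Contents (sorry-free)

* dominated-convergence lemmas for a family `u_N → φ` converging uniformly with `N`-uniform `S₀`:
  `D_t(u_N) → D_t(φ)`, `∫‖u_N‖² → ∫‖φ‖²`, `∫ u_N w → ∫ φ w` (continuous weight), `P(u_N) → P(φ)`;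
* `integrableOn_weilArchDensity_mul_weilIncrement_window`: the archimedean energy `∫₀^∞ w D_t(u) dt`
  of a window function is FINITE (domination by `w(t)·(Kt ∧ 8aS₀²)`, `integrableOn_archBound`);
* `tendsto_weilWindowForm_of_uniform`: with an `N`-uniform `S₁` as well,
  `weilWindowForm a u_N → weilWindowForm a φ` — the archimedean energy by dominated convergence in `t`
  with the bound `w(t)·(Kt on (0,1], 8aS₀² beyond)`, integrable at `0⁺` because
  `w(t) ≤ e^{t/2}/(2t)` (`weilArchDensity_le_exp_half_div`). Basis-agnostic: truncated Fourier series
  (`WeilFormatCWindowDictionary.lean`), quarter-wave or Legendre windows alike.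
-/

set_option autoImplicit false
set_option linter.dupNamespace false  -- the mandated namespace repeats `RiemannHypothesis`

noncomputable section

open Complex Filter Set MeasureTheory
open scoped Real Topology ComplexConjugate ArithmeticFunction.vonMangoldt

namespace Summit.RiemannHypothesis.RiemannHypothesis.Theorems.WeilFormatC

open Literature.NumberTheory.LFunctions

/-! ## The convergence theorem for a uniformly convergent window family -/

section Limit

variable {a : ℝ} {φ : ℝ → ℂ} {u : ℕ → ℝ → ℂ} {S₀ S₁ : ℝ} {δ : ℕ → ℝ}

/-- Dominated convergence on the window: if `u_N → φ` uniformly, all supported in `[-a,a]` and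
uniformly bounded, then `∫ F(x, u_N(x+t), u_N(x)) dx`-type integrals converge; here the instance
`∫ ‖u_N(x+t) − u_N(x)‖² dx → ∫ ‖φ(x+t) − φ(x)‖² dx`, i.e. `D_t(u_N) → D_t(φ)`. -/
theorem tendsto_weilIncrement_of_uniform (hum : ∀ N, Measurable (u N))
    (huz : ∀ N x, x ∉ Icc (-a) a → u N x = 0)
    (hub : ∀ N x, ‖u N x‖ ≤ S₀) (hnear : ∀ N x, ‖u N x - φ x‖ ≤ δ N)
    (hδ : Tendsto δ atTop (𝓝 0)) (t : ℝ) :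
    Tendsto (fun N ↦ weilIncrement (u N) t) atTop (𝓝 (weilIncrement φ t)) := by
  have hS₀ : 0 ≤ S₀ := (norm_nonneg _).trans (hub 0 0)
  have hpt : ∀ y, Tendsto (fun N ↦ u N y) atTop (𝓝 (φ y)) := by
    intro y
    rw [tendsto_iff_norm_sub_tendsto_zero]
    exact squeeze_zero (fun N ↦ norm_nonneg _) (fun N ↦ hnear N y) hδ
  unfold weilIncrement
  refine tendsto_integral_of_dominated_convergence
    (fun x ↦ 2 * S₀ ^ 2 * ((Icc (-a) a).indicator 1 (x + t) + (Icc (-a) a).indicator 1 x))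
    (fun N ↦ ((((hum N).comp (measurable_id.add_const t)).sub (hum N)).norm.pow_const 2
      |>.aestronglyMeasurable)) ?_ (fun N ↦ Eventually.of_forall fun x ↦ ?_)
    (Eventually.of_forall fun x ↦ ?_)
  · refine Integrable.const_mul (Integrable.add ?_ ?_) _
    · exact ((integrable_indicator_iff measurableSet_Icc).2
        (integrableOn_const (by simp [Real.volume_Icc]))).comp_add_right t
    · exact (integrable_indicator_iff measurableSet_Icc).2 (integrableOn_const (by simp [Real.volume_Icc]))
  · rw [Real.norm_of_nonneg (by positivity)]
    exact norm_sub_sq_le_window_bound' (huz N) (hub N) t x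
  · exact (((hpt (x + t)).sub (hpt x)).norm).pow 2

/-- Under the same hypotheses `∫ ‖u_N‖² → ∫ ‖φ‖²`. -/
theorem tendsto_integral_norm_sq_of_uniform (hum : ∀ N, Measurable (u N))
    (huz : ∀ N x, x ∉ Icc (-a) a → u N x = 0)
    (hub : ∀ N x, ‖u N x‖ ≤ S₀) (hnear : ∀ N x, ‖u N x - φ x‖ ≤ δ N)
    (hδ : Tendsto δ atTop (𝓝 0)) :
    Tendsto (fun N ↦ ∫ x : ℝ, ‖u N x‖ ^ 2) atTop (𝓝 (∫ x : ℝ, ‖φ x‖ ^ 2)) := by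
  have hS₀ : 0 ≤ S₀ := (norm_nonneg _).trans (hub 0 0)
  have hpt : ∀ y, Tendsto (fun N ↦ u N y) atTop (𝓝 (φ y)) := by
    intro y
    rw [tendsto_iff_norm_sub_tendsto_zero]
    exact squeeze_zero (fun N ↦ norm_nonneg _) (fun N ↦ hnear N y) hδ
  refine tendsto_integral_of_dominated_convergence
    (fun x ↦ S₀ ^ 2 * (Icc (-a) a).indicator 1 x)
    (fun N ↦ ((hum N).norm.pow_const 2).aestronglyMeasurable) ?_
    (fun N ↦ Eventually.of_forall fun x ↦ ?_) (Eventually.of_forall fun x ↦ ?_)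
  · exact ((integrable_indicator_iff measurableSet_Icc).2
      (integrableOn_const (by simp [Real.volume_Icc]))).const_mul _
  · rw [Real.norm_of_nonneg (by positivity)]
    by_cases hx : x ∈ Icc (-a) a
    · rw [indicator_of_mem hx, Pi.one_apply, mul_one]
      have := hub N x
      have h0 : 0 ≤ ‖u N x‖ := norm_nonneg _
      nlinarith
    · rw [huz N x hx, indicator_of_notMem hx, norm_zero, mul_zero]
      simp
  · exact ((hpt x).norm).pow 2

/-- Under the same hypotheses the weighted moments `∫ u_N(x) w(x) dx` against a continuous weight
converge (used with `w = cosh(x/2), sinh(x/2)` for the pole form). -/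
theorem tendsto_integral_mul_of_uniform {w : ℝ → ℂ} (hw : Continuous w)
    (hum : ∀ N, Measurable (u N))
    (huz : ∀ N x, x ∉ Icc (-a) a → u N x = 0)
    (hub : ∀ N x, ‖u N x‖ ≤ S₀) (hnear : ∀ N x, ‖u N x - φ x‖ ≤ δ N)
    (hδ : Tendsto δ atTop (𝓝 0)) :
    Tendsto (fun N ↦ ∫ x : ℝ, u N x * w x) atTop (𝓝 (∫ x : ℝ, φ x * w x)) := by
  have hS₀ : 0 ≤ S₀ := (norm_nonneg _).trans (hub 0 0)
  have hpt : ∀ y, Tendsto (fun N ↦ u N y) atTop (𝓝 (φ y)) := by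
    intro y
    rw [tendsto_iff_norm_sub_tendsto_zero]
    exact squeeze_zero (fun N ↦ norm_nonneg _) (fun N ↦ hnear N y) hδ
  refine tendsto_integral_of_dominated_convergence
    (fun x ↦ (Icc (-a) a).indicator (fun x ↦ S₀ * ‖w x‖) x)
    (fun N ↦ ((hum N).mul hw.measurable).aestronglyMeasurable) ?_
    (fun N ↦ Eventually.of_forall fun x ↦ ?_) (Eventually.of_forall fun x ↦ ?_)
  · exact (integrable_indicator_iff measurableSet_Icc).2
      ((continuous_const.mul hw.norm).continuousOn.integrableOn_Icc)
  · by_cases hx : x ∈ Icc (-a) a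
    · rw [indicator_of_mem hx, norm_mul]
      exact mul_le_mul_of_nonneg_right (hub N x) (norm_nonneg _)
    · rw [huz N x hx, indicator_of_notMem hx, zero_mul, norm_zero]
  · exact (hpt x).mul tendsto_const_nhds

/-- Under the same hypotheses the pole form converges: `P(u_N) → P(φ)`. -/
theorem tendsto_weilPoleForm_of_uniform (hum : ∀ N, Measurable (u N))
    (huz : ∀ N x, x ∉ Icc (-a) a → u N x = 0)
    (hub : ∀ N x, ‖u N x‖ ≤ S₀) (hnear : ∀ N x, ‖u N x - φ x‖ ≤ δ N)
    (hδ : Tendsto δ atTop (𝓝 0)) :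
    Tendsto (fun N ↦ weilPoleForm (u N)) atTop (𝓝 (weilPoleForm φ)) := by
  unfold weilPoleForm
  have hc : Continuous fun x : ℝ ↦ ((Real.cosh (x / 2) : ℝ) : ℂ) :=
    Complex.continuous_ofReal.comp (Real.continuous_cosh.comp (continuous_id.div_const 2))
  have hs : Continuous fun x : ℝ ↦ ((Real.sinh (x / 2) : ℝ) : ℂ) :=
    Complex.continuous_ofReal.comp (Real.continuous_sinh.comp (continuous_id.div_const 2))
  have h1 := tendsto_integral_mul_of_uniform hc hum huz hub hnear hδ
  have h2 := tendsto_integral_mul_of_uniform hs hum huz hub hnear hδ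
  exact ((h1.norm.pow 2).const_mul 2).sub ((h2.norm.pow 2).const_mul 2)

/-- The dominating bound `w(t) D_t(u) ≤ w(t)·(K t on (0,1], 8aS₀² beyond)`, `K = 2aS₁² + 2S₀²`,
for `t > 0` and every window function `u` with constants `S₀, S₁`. -/
theorem weilArchDensity_mul_weilIncrement_le_archBound {u : ℝ → ℂ} (ha : 0 ≤ a)
    (hm : Measurable u) (hz : ∀ x, x ∉ Icc (-a) a → u x = 0) (hb : ∀ x, ‖u x‖ ≤ S₀)
    (hl : ∀ x y, x ∈ Icc (-a) a → y ∈ Icc (-a) a → ‖u y - u x‖ ≤ S₁ * |y - x|)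
    {t : ℝ} (ht : 0 < t) :
    weilArchDensity t * weilIncrement u t ≤
      weilArchDensity t * (if t ≤ 1 then (2 * a * S₁ ^ 2 + 2 * S₀ ^ 2) * t else 8 * a * S₀ ^ 2) := by
  refine mul_le_mul_of_nonneg_left ?_ (weilArchDensity_pos ht).le
  split_ifs with h1
  · calc weilIncrement u t ≤ 2 * a * S₁ ^ 2 * t ^ 2 + 2 * S₀ ^ 2 * t :=
          weilIncrement_le_window_linear ha hm hz hb hl ht.le
      _ ≤ 2 * a * S₁ ^ 2 * t + 2 * S₀ ^ 2 * t := by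
          have : t ^ 2 ≤ t := by nlinarith
          nlinarith [mul_nonneg (mul_nonneg (by norm_num : (0:ℝ) ≤ 2) ha) (sq_nonneg S₁)]
      _ = (2 * a * S₁ ^ 2 + 2 * S₀ ^ 2) * t := by ring
  · exact weilIncrement_le_window_const ha hm hz hb t

/-- The dominating function is integrable on `(0, ∞)` (`a ≥ 0`): bounded by `K e^{1/2}/2` on
`(0, 1]` since `w(t) ≤ e^{t/2}/(2t)`, and a multiple of the integrable `w` on `(1, ∞)`. -/
theorem integrableOn_archBound (ha : 0 ≤ a) (S₀ S₁ : ℝ) :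
    IntegrableOn (fun t ↦ weilArchDensity t * (if t ≤ 1 then (2 * a * S₁ ^ 2 + 2 * S₀ ^ 2) * t else 8 * a * S₀ ^ 2)) (Ioi 0) := by
  set K : ℝ := 2 * a * S₁ ^ 2 + 2 * S₀ ^ 2 with hK
  have hK0 : 0 ≤ K := by positivity
  rw [← Ioc_union_Ioi_eq_Ioi zero_le_one]
  refine IntegrableOn.union ?_ ?_
  · have hmeas : AEStronglyMeasurable (fun t ↦ weilArchDensity t * (if t ≤ 1 then (2 * a * S₁ ^ 2 + 2 * S₀ ^ 2) * t else 8 * a * S₀ ^ 2)) volume := by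
      refine (measurable_weilArchDensity.mul ?_).aestronglyMeasurable
      exact Measurable.ite measurableSet_Iic (measurable_const.mul measurable_id) measurable_const
    refine Measure.integrableOn_of_bounded (M := K * (Real.exp (1 / 2) / 2)) (by simp) hmeas ?_
    refine (ae_restrict_iff' measurableSet_Ioc).2 (Eventually.of_forall fun t ht ↦ ?_)
    have ht0 : 0 < t := ht.1
    simp only [if_pos ht.2]
    rw [Real.norm_of_nonneg (mul_nonneg (weilArchDensity_pos ht0).le (by positivity))]
    calc weilArchDensity t * (K * t) ≤ Real.exp (t / 2) / (2 * t) * (K * t) :=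
          mul_le_mul_of_nonneg_right (weilArchDensity_le_exp_half_div ht0) (by positivity)
      _ = K * (Real.exp (t / 2) / 2) := by field_simp
      _ ≤ K * (Real.exp (1 / 2) / 2) := by
          gcongr
          linarith [ht.2]
  · have h : IntegrableOn (fun t ↦ weilArchDensity t * (8 * a * S₀ ^ 2)) (Ioi 1) :=
      (integrableOn_weilArchDensity_Ioi one_pos).mul_const (8 * a * S₀ ^ 2)
    refine h.congr_fun (fun t ht ↦ ?_) measurableSet_Ioi
    simp only [if_neg (not_le.2 (mem_Ioi.1 ht))]

/-- **The archimedean energy of a window function is finite**: `t ↦ w(t) D_t(u)` is integrable on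
`(0, ∞)` for every window function (measurable, `0` off `[-a,a]`, bounded, Lipschitz on the closed
window; `a ≥ 0`). -/
theorem integrableOn_weilArchDensity_mul_weilIncrement_window {u : ℝ → ℂ} (ha : 0 ≤ a)
    (hm : Measurable u) (hz : ∀ x, x ∉ Icc (-a) a → u x = 0) (hb : ∀ x, ‖u x‖ ≤ S₀)
    (hl : ∀ x y, x ∈ Icc (-a) a → y ∈ Icc (-a) a → ‖u y - u x‖ ≤ S₁ * |y - x|) :
    IntegrableOn (fun t ↦ weilArchDensity t * weilIncrement u t) (Ioi 0) := by
  refine (integrableOn_archBound ha S₀ S₁).mono'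
    ((measurable_weilArchDensity.mul (measurable_weilIncrement hm)).aestronglyMeasurable) ?_
  refine (ae_restrict_iff' measurableSet_Ioi).2 (Eventually.of_forall fun t ht ↦ ?_)
  rw [Real.norm_of_nonneg (mul_nonneg (weilArchDensity_pos ht).le (weilIncrement_nonneg _ _))]
  exact weilArchDensity_mul_weilIncrement_le_archBound ha hm hz hb hl ht

/-- **Continuity of the window form along a uniformly convergent window family.** Let `a > 0`,
`φ : ℝ → ℂ`, and `u_N` measurable functions vanishing off `[-a, a]`,
uniformly bounded (`‖u_N‖ ≤ S₀`), uniformly Lipschitz ON the closed window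
(`‖u_N(y) − u_N(x)‖ ≤ S₁|y − x|` for `x, y ∈ [-a,a]`; jumps at `±a` allowed) and uniformly close to
`φ` (`‖u_N − φ‖_∞ ≤ δ_N → 0`). Then `weilWindowForm a u_N → weilWindowForm a φ` (`= Re Q(φ)` when
`φ` is a test function supported in the window). Besides truncated Fourier series this covers any
other uniformly convergent window basis (Legendre, quarter-wave, …).
The archimedean energy converges by dominated convergence in `t` (`integrableOn_archBound`). -/
theorem tendsto_weilWindowForm_of_uniform (ha : 0 < a) (hum : ∀ N, Measurable (u N))
    (huz : ∀ N x, x ∉ Icc (-a) a → u N x = 0) (hub : ∀ N x, ‖u N x‖ ≤ S₀)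
    (hul : ∀ N x y, x ∈ Icc (-a) a → y ∈ Icc (-a) a → ‖u N y - u N x‖ ≤ S₁ * |y - x|)
    (hnear : ∀ N x, ‖u N x - φ x‖ ≤ δ N) (hδ : Tendsto δ atTop (𝓝 0)) :
    Tendsto (fun N ↦ weilWindowForm a (u N)) atTop (𝓝 (weilWindowForm a φ)) := by
  have hS₀ : 0 ≤ S₀ := (norm_nonneg _).trans (hub 0 0)
  have hinc : ∀ t, Tendsto (fun N ↦ weilIncrement (u N) t) atTop (𝓝 (weilIncrement φ t)) :=
    tendsto_weilIncrement_of_uniform hum huz hub hnear hδ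
  have harch : Tendsto (fun N ↦ ∫ t in Ioi (0 : ℝ), weilArchDensity t * weilIncrement (u N) t)
      atTop (𝓝 (∫ t in Ioi (0 : ℝ), weilArchDensity t * weilIncrement φ t)) := by
    refine tendsto_integral_of_dominated_convergence
      (fun t ↦ weilArchDensity t * (if t ≤ 1 then (2 * a * S₁ ^ 2 + 2 * S₀ ^ 2) * t else 8 * a * S₀ ^ 2))
      (fun N ↦ (measurable_weilArchDensity.mul (measurable_weilIncrement (hum N))).aestronglyMeasurable)
      (integrableOn_archBound ha.le S₀ S₁) (fun N ↦ ?_)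
      (Eventually.of_forall fun t ↦ (hinc t).const_mul _)
    refine (ae_restrict_iff' measurableSet_Ioi).2 (Eventually.of_forall fun t ht ↦ ?_)
    rw [Real.norm_of_nonneg (mul_nonneg (weilArchDensity_pos ht).le (weilIncrement_nonneg _ _))]
    exact weilArchDensity_mul_weilIncrement_le_archBound ha.le (hum N) (huz N) (hub N) (hul N) ht
  have hprime : Tendsto (fun N ↦ ∑ n ∈ weilPrimeIndex a,
      (Λ n : ℝ) / Real.sqrt n * weilIncrement (u N) (Real.log n)) atTop
      (𝓝 (∑ n ∈ weilPrimeIndex a, (Λ n : ℝ) / Real.sqrt n * weilIncrement φ (Real.log n))) :=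
    tendsto_finsetSum _ fun n _ ↦ (hinc _).const_mul _
  have hpole := tendsto_weilPoleForm_of_uniform hum huz hub hnear hδ
  have hnorm := tendsto_integral_norm_sq_of_uniform hum huz hub hnear hδ
  unfold weilWindowForm weilDirichletEnergy
  exact (hpole.add (hprime.add harch)).sub (hnorm.const_mul _)

end Limit

end Summit.RiemannHypothesis.RiemannHypothesis.Theorems.WeilFormatC

end
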